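import Summits.QuantumFields.GaugeBoot.DiagonalRPTorusHexLocalRest
import Summits.QuantumFields.GaugeBoot.DiagonalRPTorusPlaquetteAdjacency
import HarnessLib

/-!
# A kernel-checkable decision-tree certificate for forest splits (gauge-boot, L3 `d = 3` uniform window, J1 brick 2/4)

HONEST FRAMING (cell `pub-gaugeboot`, page 1 of every file): the venture produces certified bounds
on lattice expectations at stated coupling, gauge group, dimension and torus size; NOT a mass gap,
NOT a continuum limit, NOT a string tension; NOT Yang–Mills-summit-bearing (barriers
`FixedCouplingUltralocality`, `PerturbativeInvisibility`). This module is bookkeeping for a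
structural NEGATIVE result (a coupling window UNIFORM in the torus size for the failure of
inner-half diagonal reflection positivity on `(ℤ/L)^3`, plan note
`HOME/pub-gaugeboot-lean3/gen46/D3-UNIFORM-PLAN.md` §3 item 6c (J1)); it discharges nothing by
itself.

## Content

The doubled forest principle (`DiagRPUnif.replicaTerm_eq_zero_of_forestSplit`) kills the replica
cluster integral of a plaquette set `Q` as soon as `Q = Q₁ ⊔ Q₂` with a gauge-fixable interface
`(E₁ ∪ links Q₁) ∩ (E₂ ∪ links Q₂)`. Which sets `Q ⊆ rest`, `#Q ≤ n`, admit NO such split is a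
finite question; this file makes it KERNEL-DECIDABLE:

* `HasForestSplit E₁ E₂ Q` — the combinatorial conclusion (a split whose interface is listed by
  a leaf order, hence gauge-fixable for every group); `Cert` — a binary decision tree:
  `br p cin cout` branches on `plaq y p ∈ Q`; the leaf `sp side idx` claims a split with `Q₁`
  (or `Q₂`) = the chart images of the IN-list members at positions `idx`; `tube` claims `Q = T`.
* `check E₁ E₂ T n B IN OUT t` (Boolean, by structural recursion) — verifies the tree: at a
  split leaf it computes the PESSIMISTIC INTERFACE `pessX` (every local link of
  `E_side ∪ links S` that could lie on the other side: in `E_other`, in the links of the other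
  known members, or — unless `#IN ≥ n` forces `Q = IN` — through a rest plaquette not yet
  decided), finds a leaf order of it greedily (`pruneOrder`) and validates it (`lIsLeafOrder`).
* ★★ **`check_sound`** — if `check … [] [] t = true` (with the base on the layer `δ(y) = c - 1`,
  the data in the box `B`, `2(B+2)+2 < c`), then EVERY `Q ⊆ restPlaqs 0 1 c` with `#Q ≤ n` is
  the chart image of `T` or has a forest split. The proof is the induction over the tree; the
  leaf step is `interface_subset_pessX` (stars of charted links are charted, `rest` is the local
  test, the chart is injective on the box — bricks 1a/1b).

Elementary bookkeeping; no named fact. The certificate itself (found outside Lean, checked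
inside by `decide`) is brick 3.
-/

open Finset Function

namespace Summit.QuantumFields.GaugeBoot

open Literature.MathematicalPhysics.QuantumFieldTheory

namespace DiagRPHex

open DiagRPTube DiagRPUnif

/-! ## The combinatorial conclusion -/

section Torus

variable {L : ℕ}

/-- `Q` HAS A FOREST SPLIT for the link sets `E₁`, `E₂`: `Q = Q₁ ⊔ Q₂` with the interface
`(E₁ ∪ links Q₁) ∩ (E₂ ∪ links Q₂)` contained in a leaf-ordered list of links (hence gauge-fixable
for every group). [shape] A parametric definition of a proposition — NOT a fact. [folklore] -/
def HasForestSplit (E₁ E₂ : Finset (Edge 3 L)) (Q : Finset (Plaquette 3 L)) : Prop :=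
  ∃ Q₁ Q₂ : Finset (Plaquette 3 L), Q = Q₁ ∪ Q₂ ∧ Disjoint Q₁ Q₂ ∧
    ∃ l : List (Edge 3 L), TreeGauge.IsLeafOrder l ∧
      (E₁ ∪ linksOf Q₁) ∩ (E₂ ∪ linksOf Q₂) ⊆ l.toFinset

/-- A forest split has a gauge-fixable interface, for every group. -/
theorem HasForestSplit.exists_gaugeFixable {G : Type*} [Group G] {E₁ E₂ : Finset (Edge 3 L)}
    {Q : Finset (Plaquette 3 L)} (h : HasForestSplit E₁ E₂ Q) :
    ∃ Q₁ Q₂ : Finset (Plaquette 3 L), Q = Q₁ ∪ Q₂ ∧ Disjoint Q₁ Q₂ ∧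
      TreeGauge.GaugeFixable G ((E₁ ∪ linksOf Q₁) ∩ (E₂ ∪ linksOf Q₂)) := by
  obtain ⟨Q₁, Q₂, hQ, hd, l, hl, hsub⟩ := h
  exact ⟨Q₁, Q₂, hQ, hd, (TreeGauge.gaugeFixable_of_isLeafOrder l hl).mono hsub⟩

end Torus

/-! ## Certificates and the checker -/

/-- Decision-tree certificates. -/
inductive Cert : Type
  /-- branch on the membership of the chart image of `p` -/
  | br (p : LPlaq) (cin cout : Cert)
  /-- split leaf: side (`true` = `E₁` side) and positions in the IN-list -/
  | sp (side : Bool) (idx : List ℕ)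
  /-- the IN-list is the tube -/
  | tube

/-- Split a list by positions: `(members at positions in idx, the others)`. -/
def pick {α : Type*} (idx : List ℕ) : List α → ℕ → List α × List α
  | [], _ => ([], [])
  | a :: l, k => if k ∈ idx then (a :: (pick idx l (k + 1)).1, (pick idx l (k + 1)).2)
      else ((pick idx l (k + 1)).1, a :: (pick idx l (k + 1)).2)

/-- All links of a list of local plaquettes. -/
def llinksOf (Q : List LPlaq) : List LEdge := Q.flatMap llinks

/-- Some rest plaquette through `ℓ` is undecided (neither IN nor OUT). -/
def unknownB (IN OUT : List LPlaq) (ℓ : LEdge) : Bool :=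
  (lstar ℓ).any fun p => lrest p && !(IN.elem p) && !(OUT.elem p)

/-- The PESSIMISTIC INTERFACE of the split `S | rest` seen from the side of `Es`. -/
def pessX (Es Eo : List LEdge) (n : ℕ) (IN OUT S R : List LPlaq) : List LEdge :=
  (Es ++ llinksOf S).filter fun ℓ =>
    Eo.elem ℓ || (llinksOf R).elem ℓ || (!(decide (n ≤ IN.length)) && unknownB IN OUT ℓ)

/-- `e` is a pendant link of the list `X` (an endpoint touched by no other link of `X`). -/
def isPendant (X : List LEdge) (e : LEdge) : Bool :=
  (X.filter fun f => !(f == e)).all (fun f => !ltouch f e.1) ||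
    (X.filter fun f => !(f == e)).all (fun f => !ltouch f (e.1 + lvec e.2))

/-- Greedy leaf order of a list of links (fuelled; validated afterwards, never trusted). -/
def pruneOrder : ℕ → List LEdge → List LEdge
  | 0, _ => []
  | k + 1, X =>
    match X.find? (isPendant X) with
    | none => []
    | some e => e :: pruneOrder k (X.filter fun f => !(f == e))

/-- THE CHECKER. -/
def check (E₁ E₂ : List LEdge) (T : List LPlaq) (n B : ℕ) : Cert → List LPlaq → List LPlaq → Bool
  | .br p cin cout, IN, OUT => inBoxB B p.1 && !(IN.elem p) && !(OUT.elem p) &&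
      check E₁ E₂ T n B cin (p :: IN) OUT && check E₁ E₂ T n B cout IN (p :: OUT)
  | .tube, IN, _ => decide (IN.length = n) && IN.all (fun p => T.elem p) && T.all (fun p => IN.elem p)
  | .sp side idx, IN, OUT => decide (n < IN.length) ||
      (let SR := pick idx IN 0
       let X := pessX (if side then E₁ else E₂) (if side then E₂ else E₁) n IN OUT SR.1 SR.2
       let lo := pruneOrder X.length X
       lIsLeafOrder lo && X.all fun ℓ => lo.elem ℓ)

/-! ## Small list facts -/

/-- Members at the picked positions come from the list. -/
theorem mem_of_mem_pick_fst {α : Type*} (idx : List ℕ) :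
    ∀ (l : List α) (k : ℕ) {a : α}, a ∈ (pick idx l k).1 → a ∈ l
  | [], _, _, h => by simp [pick] at h
  | b :: l, k, a, h => by
    unfold pick at h
    split_ifs at h with hk
    · rcases List.mem_cons.1 h with rfl | h
      exacts [List.mem_cons_self, List.mem_cons_of_mem _ (mem_of_mem_pick_fst idx l (k + 1) h)]
    · exact List.mem_cons_of_mem _ (mem_of_mem_pick_fst idx l (k + 1) h)

/-- Every member is picked or not picked. -/
theorem mem_pick_or {α : Type*} (idx : List ℕ) :
    ∀ (l : List α) (k : ℕ) {a : α}, a ∈ l → a ∈ (pick idx l k).1 ∨ a ∈ (pick idx l k).2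
  | [], _, _, h => by simp at h
  | b :: l, k, a, h => by
    unfold pick
    rcases List.mem_cons.1 h with rfl | h
    · split_ifs; exacts [Or.inl List.mem_cons_self, Or.inr List.mem_cons_self]
    · rcases mem_pick_or idx l (k + 1) h with h' | h' <;> split_ifs
      exacts [Or.inl (List.mem_cons_of_mem _ h'), Or.inl h', Or.inr h',
        Or.inr (List.mem_cons_of_mem _ h')]

/-- Membership in `llinksOf`. -/
theorem mem_llinksOf {Q : List LPlaq} {ℓ : LEdge} : ℓ ∈ llinksOf Q ↔ ∃ p ∈ Q, ℓ ∈ llinks p := by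
  simp [llinksOf, List.mem_flatMap]

/-- Membership in `llinks`. -/
theorem mem_llinks {p : LPlaq} {ℓ : LEdge} : ℓ ∈ llinks p ↔ ∃ a, llink p a = ℓ := by
  simp only [llinks, List.mem_cons, List.not_mem_nil, or_false]
  constructor
  · rintro (rfl | rfl | rfl | rfl)
    exacts [⟨0, rfl⟩, ⟨1, rfl⟩, ⟨2, rfl⟩, ⟨3, rfl⟩]
  · rintro ⟨a, rfl⟩
    fin_cases a <;> simp

/-- The greedy order only uses links of its input. -/
theorem mem_of_mem_pruneOrder : ∀ (k : ℕ) (X : List LEdge) {e : LEdge}, e ∈ pruneOrder k X → e ∈ X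
  | 0, X, e, h => by simp [pruneOrder] at h
  | k + 1, X, e, h => by
    unfold pruneOrder at h
    split at h
    · simp at h
    · rename_i e₀ he₀
      rcases List.mem_cons.1 h with rfl | h
      · exact List.mem_of_find?_eq_some he₀
      · exact (List.mem_filter.1 (mem_of_mem_pruneOrder k _ h)).1

/-- Links of a box plaquette are based in the next box. -/
theorem inBox_llink {B : ℕ} {p : LPlaq} (hp : InBox B p.1) (a : Fin 4) : InBox (B + 1) (llink p a).1 := by
  fin_cases a
  exacts [hp.mono (Nat.le_succ B), inBox_add_lvec hp _, inBox_add_lvec hp _, hp.mono (Nat.le_succ B)]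

/-! ## Soundness -/

section Sound

variable {L : ℕ} [NeZero L] {c : ℕ} (y : Site 3 L) (E₁ E₂ : List LEdge) (T : List LPlaq) (n B : ℕ)

/-- Chart image of a list of local links. -/
def Et (E : List LEdge) : Finset (Edge 3 L) := (E.map (edge y)).toFinset

/-- Chart image of a list of local plaquettes. -/
def Pt (Q : List LPlaq) : Finset (Plaquette 3 L) := (Q.map (plaq y)).toFinset

variable {y E₁ E₂ T n B}

omit [NeZero L] in
/-- Membership in `Et`. -/
theorem mem_Et {E : List LEdge} {e : Edge 3 L} : e ∈ Et y E ↔ ∃ ℓ ∈ E, edge y ℓ = e := by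
  simp [Et]

omit [NeZero L] in
/-- Membership in `Pt`. -/
theorem mem_Pt {Q : List LPlaq} {q : Plaquette 3 L} : q ∈ Pt y Q ↔ ∃ p ∈ Q, plaq y p = q := by
  simp [Pt]

omit [NeZero L] in
/-- The chart image of a duplicate-free list of box plaquettes has the same size. -/
theorem card_Pt (hB : 2 * B < L) {Q : List LPlaq} (hQ : ∀ p ∈ Q, InBox B p.1) (hnd : Q.Nodup) :
    (Pt y Q).card = Q.length := by
  unfold Pt
  rw [List.card_toFinset, List.Nodup.dedup, List.length_map]
  exact hnd.map_on fun p hp p' hp' h => plaq_injOn y hB (hQ p hp) (hQ p' hp') h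

omit [NeZero L] in
/-- **A full IN-list pins `Q`**: if the chart images of the `m ≥ #Q` distinct members of `IN`
lie in `Q`, then `Q` is exactly their set. -/
theorem eq_Pt_of_full (hB : 2 * B < L) {IN : List LPlaq} (hIN : ∀ p ∈ IN, InBox B p.1)
    (hnd : IN.Nodup) {Q : Finset (Plaquette 3 L)} (hsub : ∀ p ∈ IN, plaq y p ∈ Q)
    (hcard : Q.card ≤ IN.length) : Q = Pt y IN := by
  symm
  apply Finset.eq_of_subset_of_card_le
  · intro q hq
    obtain ⟨p, hp, rfl⟩ := mem_Pt.1 hq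
    exact hsub p hp
  · rw [card_Pt hB hIN hnd]; exact hcard

/-- ★ **The interface of a split leaf lies in the chart image of the pessimistic interface.**
(`S`, `R` the picked / unpicked members of `IN`; every hypothesis of `check_sound`.) -/
theorem interface_subset_pessX (hc : 2 * (B + 2) + 2 < c) (hL : L = 2 * c)
    (hy : lay (0 : Fin 3) 1 y = ((c - 1 : ℕ) : ZMod L)) {Es Eo : List LEdge}
    (hEs : ∀ e ∈ Es, InBox B e.1) (hEo : ∀ e ∈ Eo, InBox B e.1) {IN OUT S R : List LPlaq}
    (hIN : ∀ p ∈ IN, InBox B p.1) (hnd : IN.Nodup) (hS : ∀ p ∈ S, p ∈ IN)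
    (hSR : ∀ p ∈ IN, p ∈ S ∨ p ∈ R) {Q : Finset (Plaquette 3 L)}
    (hQ : Q ⊆ restPlaqs (0 : Fin 3) 1 c) (hQn : Q.card ≤ n) (hin : ∀ p ∈ IN, plaq y p ∈ Q)
    (hout : ∀ p ∈ OUT, plaq y p ∉ Q) {e : Edge 3 L}
    (he : e ∈ (Et y Es ∪ linksOf (Pt y S)) ∩ (Et y Eo ∪ linksOf (Q \ Pt y S))) :
    ∃ ℓ ∈ pessX Es Eo n IN OUT S R, edge y ℓ = e := by
  have hBL : 2 * (B + 2) < L := by omega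
  obtain ⟨he1, he2⟩ := mem_inter.1 he
  rw [mem_union] at he1 he2
  -- the link is charted from the candidate list
  obtain ⟨ℓ, hℓc, rfl⟩ : ∃ ℓ ∈ Es ++ llinksOf S, edge y ℓ = e := by
    rcases he1 with h | h
    · obtain ⟨ℓ, hℓ, rfl⟩ := mem_Et.1 h
      exact ⟨ℓ, List.mem_append_left _ hℓ, rfl⟩
    · obtain ⟨q, hq, hqe⟩ := mem_linksOf.1 h
      obtain ⟨p, hp, rfl⟩ := mem_Pt.1 hq
      obtain ⟨a, ha⟩ := hqe
      rw [link_plaq] at ha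
      exact ⟨llink p a, List.mem_append_right _ (mem_llinksOf.2 ⟨p, hp, mem_llinks.2 ⟨a, rfl⟩⟩), ha⟩
  have hℓbox : InBox (B + 1) ℓ.1 := by
    rcases List.mem_append.1 hℓc with h | h
    · exact (hEs ℓ h).mono (Nat.le_succ B)
    · obtain ⟨p, hp, hℓp⟩ := mem_llinksOf.1 h
      obtain ⟨a, rfl⟩ := mem_llinks.1 hℓp
      exact inBox_llink (hIN p (hS p hp)) a
  refine ⟨ℓ, List.mem_filter.2 ⟨hℓc, ?_⟩, rfl⟩
  simp only [Bool.or_eq_true, List.elem_iff, Bool.and_eq_true, Bool.not_eq_true',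
    decide_eq_false_iff_not, not_le]
  rcases he2 with h | h
  · -- on the other hexagon
    obtain ⟨ℓ', hℓ', hℓ'e⟩ := mem_Et.1 h
    have : ℓ' = ℓ := edge_injOn y (by omega) ((hEo ℓ' hℓ').mono (Nat.le_succ B)) hℓbox hℓ'e
    subst this
    exact Or.inl (Or.inl hℓ')
  · -- through a plaquette of `Q` off the picked side
    obtain ⟨q, hq, hqe⟩ := mem_linksOf.1 h
    rw [mem_sdiff] at hq
    obtain ⟨hqQ, hqS⟩ := hq
    obtain ⟨p', hp'star, rfl⟩ := exists_mem_lstar_of_hasLink y hqe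
    have hp'box : InBox (B + 2) p'.1 := inBox_of_mem_lstar hℓbox hp'star
    have hp'rest : lrest p' = true := lrest_of_mem_restPlaqs hL hy hc hp'box (hQ hqQ)
    have hp'S : p' ∉ S := fun h => hqS (mem_Pt.2 ⟨p', h, rfl⟩)
    by_cases hp'IN : p' ∈ IN
    · -- a known member off the picked side
      have hp'R : p' ∈ R := (hSR p' hp'IN).resolve_left hp'S
      exact Or.inl (Or.inr (mem_llinksOf.2 ⟨p', hp'R, mem_llinks_of_mem_lstar hp'star⟩))
    · -- an undecided plaquette: the pessimistic clause
      have hp'OUT : p' ∉ OUT := fun h => hout p' h hqQ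
      refine Or.inr ⟨?_, ?_⟩
      · -- not full: otherwise `Q = Pt IN` and `p' ∈ IN`
        by_contra hfull
        rw [not_lt] at hfull
        have hQeq := eq_Pt_of_full (by omega : 2 * B < L) hIN hnd hin (hQn.trans hfull)
        rw [hQeq] at hqQ
        obtain ⟨p'', hp'', he''⟩ := mem_Pt.1 hqQ
        have : p'' = p' := plaq_injOn y hBL ((hIN p'' hp'').mono (by omega)) hp'box he''
        exact hp'IN (this ▸ hp'')
      · unfold unknownB
        rw [List.any_eq_true]
        refine ⟨p', hp'star, ?_⟩
        simp [hp'rest, hp'IN, hp'OUT]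

/-- ★★ **SOUNDNESS OF THE CHECKER.** -/
theorem check_sound (hc : 2 * (B + 2) + 2 < c) (hL : L = 2 * c)
    (hy : lay (0 : Fin 3) 1 y = ((c - 1 : ℕ) : ZMod L))
    (hE₁ : ∀ e ∈ E₁, InBox B e.1) (hE₂ : ∀ e ∈ E₂, InBox B e.1) :
    ∀ (t : Cert) (IN OUT : List LPlaq), (∀ p ∈ IN, InBox B p.1) → IN.Nodup →
      check E₁ E₂ T n B t IN OUT = true →
      ∀ Q : Finset (Plaquette 3 L), Q ⊆ restPlaqs (0 : Fin 3) 1 c → Q.card ≤ n →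
        (∀ p ∈ IN, plaq y p ∈ Q) → (∀ p ∈ OUT, plaq y p ∉ Q) →
        Q = Pt y T ∨ HasForestSplit (Et y E₁) (Et y E₂) Q
  | .br p cin cout, IN, OUT, hIN, hnd, hch, Q, hQ, hQn, hin, hout => by
    simp only [check, Bool.and_eq_true, Bool.not_eq_true', List.elem_eq_mem, decide_eq_false_iff_not] at hch
    obtain ⟨⟨⟨⟨hbox, hpIN⟩, -⟩, hcin⟩, hcout⟩ := hch
    have hpbox := inBox_of_inBoxB hbox
    by_cases hpQ : plaq y p ∈ Q
    · refine check_sound hc hL hy hE₁ hE₂ cin (p :: IN) OUT ?_ (List.nodup_cons.2 ⟨hpIN, hnd⟩) hcin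
        Q hQ hQn ?_ hout
      · intro q hq
        rcases List.mem_cons.1 hq with rfl | hq; exacts [hpbox, hIN q hq]
      · intro q hq
        rcases List.mem_cons.1 hq with rfl | hq; exacts [hpQ, hin q hq]
    · refine check_sound hc hL hy hE₁ hE₂ cout IN (p :: OUT) hIN hnd hcout Q hQ hQn hin ?_
      intro q hq
      rcases List.mem_cons.1 hq with rfl | hq; exacts [hpQ, hout q hq]
  | .tube, IN, OUT, hIN, hnd, hch, Q, hQ, hQn, hin, hout => by
    have hBL : 2 * B < L := by omega
    simp only [check, Bool.and_eq_true, decide_eq_true_eq, List.all_eq_true, List.elem_iff] at hch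
    obtain ⟨⟨hlen, hIT⟩, hTI⟩ := hch
    left
    have hQeq := eq_Pt_of_full hBL hIN hnd hin (hQn.trans hlen.symm.le)
    rw [hQeq]
    ext q
    simp only [mem_Pt]
    exact ⟨fun ⟨p, hp, he⟩ => ⟨p, hIT p hp, he⟩, fun ⟨p, hp, he⟩ => ⟨p, hTI p hp, he⟩⟩
  | .sp side idx, IN, OUT, hIN, hnd, hch, Q, hQ, hQn, hin, hout => by
    have hBL : 2 * B < L := by omega
    simp only [check, Bool.or_eq_true, decide_eq_true_eq, Bool.and_eq_true, List.all_eq_true,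
      List.elem_iff] at hch
    rcases hch with hlt | ⟨hlo, hall⟩
    · -- more known members than `Q` has room for
      have := card_Pt (y := y) hBL hIN hnd
      have := Finset.card_le_card (show Pt y IN ⊆ Q from fun q hq => by
        obtain ⟨p, hp, rfl⟩ := mem_Pt.1 hq; exact hin p hp)
      omega
    · right
      set S := (pick idx IN 0).1 with hSdef
      set R := (pick idx IN 0).2 with hRdef
      have hS : ∀ p ∈ S, p ∈ IN := fun p hp => mem_of_mem_pick_fst idx IN 0 hp
      have hSR : ∀ p ∈ IN, p ∈ S ∨ p ∈ R := fun p hp => mem_pick_or idx IN 0 hp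
      have hPS : Pt y S ⊆ Q := fun q hq => by
        obtain ⟨p, hp, rfl⟩ := mem_Pt.1 hq; exact hin p (hS p hp)
      -- the two sides, uniformly
      set Es := (if side then E₁ else E₂) with hEs
      set Eo := (if side then E₂ else E₁) with hEo
      have hEs' : ∀ e ∈ Es, InBox B e.1 := fun e he => by
        rw [hEs] at he; split_ifs at he; exacts [hE₁ e he, hE₂ e he]
      have hEo' : ∀ e ∈ Eo, InBox B e.1 := fun e he => by
        rw [hEo] at he; split_ifs at he; exacts [hE₂ e he, hE₁ e he]
      set X := pessX Es Eo n IN OUT S R with hX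
      set lo := pruneOrder X.length X with hlodef
      have hlobox : ∀ ℓ ∈ lo, InBox (B + 1) ℓ.1 := by
        intro ℓ hℓ
        have hℓX : ℓ ∈ X := mem_of_mem_pruneOrder _ _ hℓ
        have hℓc := (List.mem_filter.1 hℓX).1
        rcases List.mem_append.1 hℓc with h | h
        · exact (hEs' ℓ h).mono (Nat.le_succ B)
        · obtain ⟨p, hp, hℓp⟩ := mem_llinksOf.1 h
          obtain ⟨a, rfl⟩ := mem_llinks.1 hℓp
          exact inBox_llink (hIN p (hS p hp)) a
      have hleaf : TreeGauge.IsLeafOrder (lo.map (edge y)) :=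
        isLeafOrder_map_edge y (by omega) lo hlobox hlo
      have hsubset : (Et y Es ∪ linksOf (Pt y S)) ∩ (Et y Eo ∪ linksOf (Q \ Pt y S)) ⊆
          (lo.map (edge y)).toFinset := by
        intro e he
        obtain ⟨ℓ, hℓX, rfl⟩ := interface_subset_pessX hc hL hy hEs' hEo' hIN hnd hS hSR hQ hQn
          hin hout he
        rw [List.mem_toFinset]
        exact List.mem_map.2 ⟨ℓ, hall ℓ hℓX, rfl⟩
      cases side
      · -- `S` on the `E₂` side: `Q₁ = Q \ Pt S`, `Q₂ = Pt S`
        refine ⟨Q \ Pt y S, Pt y S, ?_, disjoint_sdiff_self_left, lo.map (edge y), hleaf, ?_⟩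
        · rw [sdiff_union_of_subset hPS]
        · rw [inter_comm]
          simpa [hEs, hEo] using hsubset
      · -- `S` on the `E₁` side: `Q₁ = Pt S`, `Q₂ = Q \ Pt S`
        refine ⟨Pt y S, Q \ Pt y S, ?_, disjoint_sdiff_self_right, lo.map (edge y), hleaf, ?_⟩
        · rw [union_sdiff_of_subset hPS]
        · simpa [hEs, hEo] using hsubset

/-- ★★ **SOUNDNESS, closed form**: a certificate checked from the empty state classifies every
small rest cluster. -/
theorem eq_tube_or_hasForestSplit_of_check (hc : 2 * (B + 2) + 2 < c) (hL : L = 2 * c)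
    (hy : lay (0 : Fin 3) 1 y = ((c - 1 : ℕ) : ZMod L))
    (hE₁ : ∀ e ∈ E₁, InBox B e.1) (hE₂ : ∀ e ∈ E₂, InBox B e.1) {t : Cert}
    (ht : check E₁ E₂ T n B t [] [] = true) {Q : Finset (Plaquette 3 L)}
    (hQ : Q ⊆ restPlaqs (0 : Fin 3) 1 c) (hQn : Q.card ≤ n) :
    Q = Pt y T ∨ HasForestSplit (Et y E₁) (Et y E₂) Q :=
  check_sound hc hL hy hE₁ hE₂ t [] [] (by simp) List.nodup_nil ht Q hQ hQn (by simp) (by simp)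

end Sound

end DiagRPHex

end Summit.QuantumFields.GaugeBoot
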